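import Mathlib
import Summits.KontsevichZagierPeriods.KontsevichZagierPeriods.Theorems.SoloInformedLegendreArcsine
import Literature.NumberTheory.Transcendental.KZBallPeelingAux
import Literature.NumberTheory.Transcendental.KZSemiCanonicalReductionProofs
import HarnessLib
import HarnessLib.Audit

/-!
# SoloInformed — Legendre relation X: Gauss's AGM step is a theorem of the calculus

Solo-informed residency (s33), file X of the Legendre chain.  The arithmetic–geometric-mean
invariance of `I(a,b) = ∫₀^∞ dt/√((a²+t²)(b²+t²))`, `I(a,b) = I((a+b)/2, √(ab))` (Gauss 1799), is
realised by the Kontsevich–Zagier moves.  We work with the AGM REPRESENTATIONS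
`G_{A,B} = [(0,∞), ((A+t²)(B+t²))^{-1/2}]` (`A, B > 0` real algebraic) and prove, in the normalised
case `A·B = 1` (to which homogeneity reduces everything, and which keeps every threshold rational):

* (`soloInformed_gauss_agm_step`) `G_{A,B} ∼ G_{(A+B+2)/4, 1}` — Gauss's step `(a,b) ↦ ((a+b)/2, 1)`
  for `ab = 1` — by: domain additivity at `t = 1`; the involution `t ↦ 1/t` (rule 2) carrying
  `(0,1)` onto `(1,∞)` and preserving the form when `AB = 1`; integrand additivity; and NEWMAN'S
  SUBSTITUTION `x = (t − 1/t)/2` (rule 2) from `(1,∞)` onto `(0,∞)`, under which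
  `(A+B+2)/4 + x² = (A+t²)(B+t²)/(4t²)` and `1 + x² = (1+t²)²/(4t²)`;
* (`soloInformed_agm_homogeneity`) `⟦G_{λ²A, λ²B}⟧ = ⟦[pt, λ⁻¹]⟧·⟦G_{A,B}⟧` by `t = λs`.

File XI turns these into LANDEN'S TRANSFORMATION in `P` and the first CM relation at the
singular modulus `k = √2 − 1`.

References: C. F. Gauss, *Werke* III (AGM, 1799); D. J. Newman, "A simplified version of the fast
algorithms of Brent and Salamin", Math. Comp. 44 (1985) 207–210 (the substitution
`x = (t − ab/t)/2`); J. M. & P. B. Borwein, *Pi and the AGM* (1987), § 1.1; this work (s23 lift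
lemma `SoloInformedLiftMoves`, s33).
-/

noncomputable section

open MeasureTheory Set Filter
open scoped Classical

open Literature.NumberTheory.Transcendental Literature.NumberTheory.Transcendental.KZ
open Literature.ModelTheory.ExponentialFields

namespace Summit.KontsevichZagierPeriods.KontsevichZagierPeriods.Theorems

/-! ### Rational half-lines and intervals in `ℝ¹` -/

/-- `(0,∞) ⊂ ℝ¹` is `ℚ`-semialgebraic. [folklore] -/
theorem soloInformed_isSemialgebraic_Ioi_zero :
    IsSemialgebraic ℚ {x : Fin 1 → ℝ | x 0 ∈ Ioi (0:ℝ)} := by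
  have h := isSemialgebraic_setOf_eval_pos (k := ℚ) (R := ℝ) (MvPolynomial.X (0 : Fin 1))
  convert h using 1
  ext x
  simp

/-- `(1,∞) ⊂ ℝ¹` is `ℚ`-semialgebraic. [folklore] -/
theorem soloInformed_isSemialgebraic_Ioi_one :
    IsSemialgebraic ℚ {x : Fin 1 → ℝ | x 0 ∈ Ioi (1:ℝ)} := by
  have h := isSemialgebraic_setOf_eval_pos (k := ℚ) (R := ℝ) (MvPolynomial.X (0 : Fin 1) - 1)
  convert h using 1
  ext x
  simp [sub_pos]

/-- `(0,1] ⊂ ℝ¹` is `ℚ`-semialgebraic. [folklore] -/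
theorem soloInformed_isSemialgebraic_Ioc :
    IsSemialgebraic ℚ {x : Fin 1 → ℝ | x 0 ∈ Ioc (0:ℝ) 1} := by
  have h := (isSemialgebraic_setOf_eval_pos (k := ℚ) (R := ℝ) (MvPolynomial.X (0 : Fin 1))).inter
    (isSemialgebraic_setOf_eval_le (k := ℚ) (R := ℝ) (MvPolynomial.X (0 : Fin 1)) 1)
  convert h using 1
  ext x
  simp

/-! ### The AGM representations `G_{A,B} = [S, ((A+t²)(B+t²))^{-1/2}]` -/

/-- The AGM kernel `t ↦ ((A+t²)(B+t²))^{-1/2}` (`A, B > 0`) is integrable on `ℝ`: it is continuous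
and `≤ m⁻¹(1+t²)⁻¹` with `m = min(A,B,1)`. [folklore] -/
theorem soloInformed_integrable_agmKernel {A B : ℝ} (hA : 0 < A) (hB : 0 < B) :
    Integrable fun t : ℝ => (√(A + t ^ 2))⁻¹ * (√(B + t ^ 2))⁻¹ := by
  set m : ℝ := min (min A B) 1 with hm
  have hm0 : 0 < m := lt_min (lt_min hA hB) one_pos
  have hmA : m ≤ A := (min_le_left _ _).trans (min_le_left _ _)
  have hmB : m ≤ B := (min_le_left _ _).trans (min_le_right _ _)
  have hm1 : m ≤ 1 := min_le_right _ _
  refine (integrable_inv_one_add_sq.const_mul m⁻¹).mono' ?_ (ae_of_all _ fun t => ?_)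
  · exact (by fun_prop :
      Measurable fun t : ℝ => (√(A + t ^ 2))⁻¹ * (√(B + t ^ 2))⁻¹).aestronglyMeasurable
  · have h1 : 0 < 1 + t ^ 2 := by positivity
    have ht2 : 0 ≤ t ^ 2 := sq_nonneg t
    have hsA : √(m * (1 + t ^ 2)) ≤ √(A + t ^ 2) := Real.sqrt_le_sqrt (by nlinarith)
    have hsB : √(m * (1 + t ^ 2)) ≤ √(B + t ^ 2) := Real.sqrt_le_sqrt (by nlinarith)
    have hs0 : 0 ≤ √(m * (1 + t ^ 2)) := Real.sqrt_nonneg _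
    have hprod : m * (1 + t ^ 2) ≤ √(A + t ^ 2) * √(B + t ^ 2) := by
      have := mul_le_mul hsA hsB hs0 (Real.sqrt_nonneg _)
      rwa [Real.mul_self_sqrt (by positivity)] at this
    rw [Real.norm_eq_abs, abs_of_nonneg (by positivity), ← mul_inv, ← mul_inv]
    exact inv_anti₀ (by positivity) hprod

/-- **The AGM representations.** For real algebraic `A, B > 0` and a measurable `S ⊆ ℝ` whose
coordinate copy `{x | x₀ ∈ S} ⊂ ℝ¹` is `ℚ`-semialgebraic there is a representation
`G_{A,B} = [S, ((A+t²)(B+t²))^{-1/2}]`. [this work] -/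
theorem soloInformed_exists_agm_rep {A B : ℝ} (hA : 0 < A) (hB : 0 < B) (hAa : IsAlgebraic ℚ A)
    (hBa : IsAlgebraic ℚ B) (S : Set ℝ)
    (hS : IsSemialgebraic ℚ {x : Fin 1 → ℝ | x 0 ∈ S}) :
    ∃ G : IntegralRep 1, G.domain = {x : Fin 1 → ℝ | x 0 ∈ S} ∧
      ∀ x, G.integrand x = (√(A + x 0 ^ 2))⁻¹ * (√(B + x 0 ^ 2))⁻¹ := by
  have hlin : ∀ {C : ℝ}, IsAlgebraic ℚ C →
      IsSemialgebraicFunOn ℚ {x : Fin 1 → ℝ | x 0 ∈ S} (fun x : Fin 1 → ℝ => C + x 0 ^ 2) :=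
    fun hC => ((isSemialgebraicFunOn_const_of_isAlgebraic hS hC).add_holds
      (isSemialgebraicFunOn_aeval hS (MvPolynomial.X 0 ^ 2))).congr fun x _ => by
        simp only [Pi.add_apply, map_pow, MvPolynomial.aeval_X]
  have hsa : IsSemialgebraicFunOn ℚ {x : Fin 1 → ℝ | x 0 ∈ S}
      (fun x : Fin 1 → ℝ => (√(A + x 0 ^ 2))⁻¹ * (√(B + x 0 ^ 2))⁻¹) :=
    (((IsSemialgebraicFunOn.sqrt_holds (hlin hAa)).inv fun x _ =>
      (Real.sqrt_pos.2 (by positivity)).ne').mul_holds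
      ((IsSemialgebraicFunOn.sqrt_holds (hlin hBa)).inv fun x _ =>
      (Real.sqrt_pos.2 (by positivity)).ne')).congr fun x _ => by simp only [Pi.mul_apply]
  have hint : IntegrableOn (fun x : Fin 1 → ℝ => (√(A + x 0 ^ 2))⁻¹ * (√(B + x 0 ^ 2))⁻¹)
      {x : Fin 1 → ℝ | x 0 ∈ S} := by
    have hmp : MeasurePreserving (MeasurableEquiv.funUnique (Fin 1) ℝ) volume volume :=
      volume_preserving_funUnique (Fin 1) ℝ
    have hset : {x : Fin 1 → ℝ | x 0 ∈ S} = (MeasurableEquiv.funUnique (Fin 1) ℝ) ⁻¹' S := by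
      ext x
      simp [MeasurableEquiv.funUnique, Fin.default_eq_zero]
    rw [hset]
    exact (hmp.integrableOn_comp_preimage
      (MeasurableEquiv.funUnique (Fin 1) ℝ).measurableEmbedding).2
      (soloInformed_integrable_agmKernel hA hB).integrableOn
  exact ⟨⟨_, _, hS, hsa, hint⟩, rfl, fun x => rfl⟩

/-! ### Move: the involution `t ↦ 1/t` (for `AB = 1`) -/

/-- **Inversion move.** For `A·B = 1` the substitution `t ↦ 1/t` (rule 2) carries
`[(0,1), ((A+t²)(B+t²))^{-1/2}]` to `[(1,∞), ((A+t²)(B+t²))^{-1/2}]`: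
`(A + t⁻²)(B + t⁻²)·t⁴ = (At²+1)(Bt²+1) = (A+t²)(B+t²)` when `AB = 1`. [this work] -/
theorem soloInformed_agm_inversion_move {A B : ℝ} (hA : 0 < A) (hB : 0 < B) (hAB : A * B = 1)
    (Gs G1 : IntegralRep 1)
    (hsd : Gs.domain = {x : Fin 1 → ℝ | x 0 ∈ Ioo (0:ℝ) 1})
    (hsi : ∀ x, Gs.integrand x = (√(A + x 0 ^ 2))⁻¹ * (√(B + x 0 ^ 2))⁻¹)
    (h1d : G1.domain = {x : Fin 1 → ℝ | x 0 ∈ Ioi (1:ℝ)})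
    (h1i : ∀ x, G1.integrand x = (√(A + x 0 ^ 2))⁻¹ * (√(B + x 0 ^ 2))⁻¹) :
    of Gs - of G1 ∈ changeOfVariablesRel := by
  have hsq := BallPeeling.isSemialgebraic_posIoo
  refine soloInformed_lift_mem_changeOfVariablesRel Gs G1 (g := fun t => t⁻¹)
    (g' := fun t => -(t ^ 2)⁻¹) (S := Ioo (0:ℝ) 1) (T := Ioi (1:ℝ)) hsd h1d ?_
    (fun t ht => hasDerivAt_inv ht.1.ne') (fun a _ b _ h => inv_injective h) ?_ ?_
  · rw [hsd]
    refine IsSemialgebraicMapOn.of_forall hsq fun j => ?_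
    refine ((isSemialgebraicFunOn_aeval hsq (MvPolynomial.X 0)).inv fun x hx => ?_).congr
      fun x _ => ?_
    · have h : x 0 ∈ Ioo (0:ℝ) 1 := hx
      simp only [MvPolynomial.aeval_X]
      exact h.1.ne'
    · simp only [MvPolynomial.aeval_X, soloInformedLift]
  · rw [image_inv_eq_inv, inv_Ioo_0_left one_pos, inv_one]
  · intro x hx
    have ht : x 0 ∈ Ioo (0:ℝ) 1 := by rw [hsd] at hx; exact hx
    have ht0 : x 0 ≠ 0 := ht.1.ne'
    have hA1 : 0 < A * x 0 ^ 2 + 1 := by positivity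
    have hB1 : 0 < B * x 0 ^ 2 + 1 := by positivity
    have hsA : √(A * x 0 ^ 2 + 1) ≠ 0 := (Real.sqrt_pos.2 hA1).ne'
    have hsB : √(B * x 0 ^ 2 + 1) ≠ 0 := (Real.sqrt_pos.2 hB1).ne'
    have hsA' : √(A + x 0 ^ 2) ≠ 0 := (Real.sqrt_pos.2 (by positivity)).ne'
    have hsB' : √(B + x 0 ^ 2) ≠ 0 := (Real.sqrt_pos.2 (by positivity)).ne'
    have key : √(A + x 0 ^ 2) * √(B + x 0 ^ 2) = √(A * x 0 ^ 2 + 1) * √(B * x 0 ^ 2 + 1) := by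
      rw [← Real.sqrt_mul (by positivity), ← Real.sqrt_mul hA1.le]
      congr 1
      linear_combination (1 - x 0 ^ 4) * hAB
    rw [hsi, h1i]
    simp only [soloInformedLift]
    have e1 : A + (x 0)⁻¹ ^ 2 = (A * x 0 ^ 2 + 1) / x 0 ^ 2 := by field_simp
    have e2 : B + (x 0)⁻¹ ^ 2 = (B * x 0 ^ 2 + 1) / x 0 ^ 2 := by field_simp
    rw [e1, e2, Real.sqrt_div' _ (sq_nonneg _), Real.sqrt_div' _ (sq_nonneg _),
      Real.sqrt_sq ht.1.le, abs_neg, abs_of_pos (by positivity)]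
    rw [show (√(A * x 0 ^ 2 + 1) / x 0)⁻¹ * (√(B * x 0 ^ 2 + 1) / x 0)⁻¹ * (x 0 ^ 2)⁻¹ =
      (√(A * x 0 ^ 2 + 1) * √(B * x 0 ^ 2 + 1))⁻¹ by field_simp, ← key, mul_inv]

/-! ### Move: Newman's substitution `x = (t − 1/t)/2` -/

/-- **Newman's move.** For `A·B = 1` the substitution `x = (t − 1/t)/2` (rule 2) carries
`[(1,∞), 2·((A+t²)(B+t²))^{-1/2}]` onto `[(0,∞), (((A+B+2)/4 + x²)(1 + x²))^{-1/2}]`.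
[Newman 1985; this work] -/
theorem soloInformed_newman_move {A B : ℝ} (hA : 0 < A) (hB : 0 < B) (hAB : A * B = 1)
    (G1 G0' : IntegralRep 1)
    (h1d : G1.domain = {x : Fin 1 → ℝ | x 0 ∈ Ioi (1:ℝ)})
    (h1i : ∀ x, G1.integrand x = (√(A + x 0 ^ 2))⁻¹ * (√(B + x 0 ^ 2))⁻¹)
    (h0d : G0'.domain = {x : Fin 1 → ℝ | x 0 ∈ Ioi (0:ℝ)})
    (h0i : ∀ x, G0'.integrand x = (√((A + B + 2) / 4 + x 0 ^ 2))⁻¹ * (√(1 + x 0 ^ 2))⁻¹)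
    (h2 : IsAlgebraic ℚ (2:ℝ)) :
    of (G1.constMul 2 h2) - of G0' ∈ changeOfVariablesRel := by
  have hS := soloInformed_isSemialgebraic_Ioi_one
  refine soloInformed_lift_mem_changeOfVariablesRel (G1.constMul 2 h2) G0'
    (g := fun t => (t - t⁻¹) / 2) (g' := fun t => (1 + (t ^ 2)⁻¹) / 2)
    (S := Ioi (1:ℝ)) (T := Ioi (0:ℝ)) (by rw [IntegralRep.domain_constMul, h1d]) h0d ?_
    (fun t ht => ?_) ?_ ?_ ?_
  · rw [IntegralRep.domain_constMul, h1d]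
    refine IsSemialgebraicMapOn.of_forall hS fun j => ?_
    have hx : IsSemialgebraicFunOn ℚ {x : Fin 1 → ℝ | x 0 ∈ Ioi (1:ℝ)} (fun x : Fin 1 → ℝ => x 0) :=
      (isSemialgebraicFunOn_aeval hS (MvPolynomial.X 0)).congr fun x _ => by
        simp only [MvPolynomial.aeval_X]
    refine ((hx.sub_holds (hx.inv fun x hx' => ?_)).mul_holds
      (isSemialgebraicFunOn_const_of_isAlgebraic hS h2.inv)).congr fun x _ => ?_
    · have h : (1:ℝ) < x 0 := hx'
      positivity
    · simp only [Pi.mul_apply, Pi.sub_apply, soloInformedLift, div_eq_mul_inv]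
  · have ht0 : t ≠ 0 := (zero_lt_one.trans ht).ne'
    have h := ((hasDerivAt_id' t).sub (hasDerivAt_inv ht0)).div_const 2
    refine h.congr_deriv ?_
    ring
  · intro a ha b hb h
    have ha0 : (0:ℝ) < a := zero_lt_one.trans ha
    have hb0 : (0:ℝ) < b := zero_lt_one.trans hb
    have h' : (a - a⁻¹) / 2 = (b - b⁻¹) / 2 := h
    have e : (a - b) * (a * b + 1) = ((a - a⁻¹) / 2 - (b - b⁻¹) / 2) * (a * b) * 2 := by
      field_simp
      ring
    rw [h', sub_self, zero_mul, zero_mul] at e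
    rcases mul_eq_zero.1 e with e | e
    · linarith
    · nlinarith [mul_pos ha0 hb0]
  · ext y
    constructor
    · rintro ⟨t, ht, rfl⟩
      have ht1 : (1:ℝ) < t := ht
      have : t⁻¹ < 1 := inv_lt_one_of_one_lt₀ ht1
      show (0:ℝ) < (t - t⁻¹) / 2
      linarith
    · intro hy
      have hy0 : (0:ℝ) < y := hy
      have hs : √(y ^ 2 + 1) ^ 2 = y ^ 2 + 1 := Real.sq_sqrt (by positivity)
      have hs1 : 1 ≤ √(y ^ 2 + 1) := by
        have h := Real.sqrt_le_sqrt (show (1:ℝ) ≤ y ^ 2 + 1 by nlinarith)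
        rwa [Real.sqrt_one] at h
      refine ⟨y + √(y ^ 2 + 1), ?_, ?_⟩
      · show (1:ℝ) < y + √(y ^ 2 + 1)
        linarith
      · have hinv : (y + √(y ^ 2 + 1))⁻¹ = √(y ^ 2 + 1) - y := by
          rw [← (eq_inv_of_mul_eq_one_left (by nlinarith [hs] :
            (√(y ^ 2 + 1) - y) * (y + √(y ^ 2 + 1)) = 1))]
        show (y + √(y ^ 2 + 1) - (y + √(y ^ 2 + 1))⁻¹) / 2 = y
        rw [hinv]
        ring
  · intro x hx
    rw [IntegralRep.domain_constMul, h1d] at hx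
    have ht : (1:ℝ) < x 0 := hx
    have ht0 : (0:ℝ) < x 0 := zero_lt_one.trans ht
    have hAt : 0 < A + x 0 ^ 2 := by positivity
    have hBt : 0 < B + x 0 ^ 2 := by positivity
    have hsA : √(A + x 0 ^ 2) ≠ 0 := (Real.sqrt_pos.2 hAt).ne'
    have hsB : √(B + x 0 ^ 2) ≠ 0 := (Real.sqrt_pos.2 hBt).ne'
    simp only [IntegralRep.integrand_constMul, h1i, h0i, soloInformedLift]
    have e1 : (A + B + 2) / 4 + ((x 0 - (x 0)⁻¹) / 2) ^ 2 =
        ((A + x 0 ^ 2) * (B + x 0 ^ 2)) / (2 * x 0) ^ 2 := by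
      field_simp
      linear_combination (-4) * hAB
    have e2 : 1 + ((x 0 - (x 0)⁻¹) / 2) ^ 2 = (x 0 ^ 2 + 1) ^ 2 / (2 * x 0) ^ 2 := by
      field_simp
      ring
    rw [e1, e2, Real.sqrt_div' _ (sq_nonneg _), Real.sqrt_div' _ (sq_nonneg _),
      Real.sqrt_sq (by positivity), Real.sqrt_sq (by positivity), Real.sqrt_mul hAt.le,
      abs_of_pos (by positivity)]
    field_simp

/-! ### Gauss's AGM step (normalised) and homogeneity -/

/-- **GAUSS'S AGM STEP IS A THEOREM OF THE CALCULUS (normalised form).** For real algebraic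
`A, B > 0` with `A·B = 1`: `G_{A,B} ∼ G_{(A+B+2)/4, 1}` on `(0,∞)`, i.e.
`I(a, 1/a) = I((a + 1/a)/2, 1)`, by five moves: split `(0,∞)` at `1`, invert `(0,1)` onto
`(1,∞)`, add the two equal halves, and apply Newman's substitution. [Gauss 1799; this work] -/
theorem soloInformed_gauss_agm_step {A B : ℝ} (hA : 0 < A) (hB : 0 < B) (hAa : IsAlgebraic ℚ A)
    (hBa : IsAlgebraic ℚ B) (hAB : A * B = 1) (G0 G0' : IntegralRep 1)
    (h0d : G0.domain = {x : Fin 1 → ℝ | x 0 ∈ Ioi (0:ℝ)})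
    (h0i : ∀ x, G0.integrand x = (√(A + x 0 ^ 2))⁻¹ * (√(B + x 0 ^ 2))⁻¹)
    (h0'd : G0'.domain = {x : Fin 1 → ℝ | x 0 ∈ Ioi (0:ℝ)})
    (h0'i : ∀ x, G0'.integrand x = (√((A + B + 2) / 4 + x 0 ^ 2))⁻¹ * (√(1 + x 0 ^ 2))⁻¹) :
    Equivalent G0 G0' := by
  obtain ⟨Gs, hsd, hsi⟩ := soloInformed_exists_agm_rep hA hB hAa hBa (Ioo (0:ℝ) 1)
    BallPeeling.isSemialgebraic_posIoo
  obtain ⟨Gc, hcd, hci⟩ := soloInformed_exists_agm_rep hA hB hAa hBa (Ioc (0:ℝ) 1)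
    soloInformed_isSemialgebraic_Ioc
  obtain ⟨G1, h1d, h1i⟩ := soloInformed_exists_agm_rep hA hB hAa hBa (Ioi (1:ℝ))
    soloInformed_isSemialgebraic_Ioi_one
  have h2 : IsAlgebraic ℚ (2:ℝ) := by simpa using isAlgebraic_nat (R := ℚ) (A := ℝ) 2
  -- (a) domain additivity at `t = 1`
  have ha : of G0 - of Gc - of G1 ∈ relations := by
    refine domainAddRel_subset_relations ⟨1, G0, Gc, G1, ?_, ?_, fun x _ => by rw [h0i, hci],
      fun x _ => by rw [h0i, h1i], rfl⟩
    · rw [h0d, hcd, h1d]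
      ext x
      simp only [mem_setOf_eq, mem_union, mem_Ioc, mem_Ioi]
      constructor
      · intro h
        by_cases h1 : x 0 ≤ 1
        · exact Or.inl ⟨h, h1⟩
        · exact Or.inr (not_le.1 h1)
      · rintro (⟨h, _⟩ | h)
        · exact h
        · exact zero_lt_one.trans h
    · rw [hcd, h1d]
      exact measure_mono_null (fun x hx => (not_lt.2 hx.1.2 hx.2).elim)
        (BallPeeling.volume_setOf_apply_eq_const 1 0 1)
  -- (b) null modification `(0,1] ∼ (0,1)`
  have hb : of Gc - of Gs ∈ relations := by
    refine of_sub_of_mem_relations_of_null Gc Gs ?_ ?_ (fun x _ => by rw [hci, hsi])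
    · rw [hcd, hsd]
      exact measure_mono_null
        (fun x hx => le_antisymm hx.1.2 (not_lt.1 fun h => hx.2 ⟨hx.1.1, h⟩))
        (BallPeeling.volume_setOf_apply_eq_const 1 0 1)
    · rw [hcd, hsd]
      exact measure_mono_null (fun x hx => (hx.2 ⟨hx.1.1, hx.1.2.le⟩).elim)
        (BallPeeling.volume_setOf_apply_eq_const 1 0 1)
  -- (c) inversion `(0,1) → (1,∞)`
  have hc := changeOfVariablesRel_subset_relations
    (soloInformed_agm_inversion_move hA hB hAB Gs G1 hsd hsi h1d h1i)
  -- (d) integrand additivity `2f = f + f`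
  have hd : of (G1.constMul 2 h2) - of G1 - of G1 ∈ relations :=
    integrandAddRel_subset_relations ⟨1, G1.constMul 2 h2, G1, G1,
      by rw [IntegralRep.domain_constMul], by rw [IntegralRep.domain_constMul],
      fun x _ => by simp [IntegralRep.integrand_constMul, two_mul], rfl⟩
  -- (e) Newman
  have he := changeOfVariablesRel_subset_relations
    (soloInformed_newman_move hA hB hAB G1 G0' h1d h1i h0'd h0'i h2)
  have e : of G0 - of G0' = (of G0 - of Gc - of G1) + (of Gc - of Gs) + (of Gs - of G1)
      - (of (G1.constMul 2 h2) - of G1 - of G1) + (of (G1.constMul 2 h2) - of G0') := by abel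
  show of G0 - of G0' ∈ relations
  rw [e]
  exact relations.add_mem (relations.sub_mem (relations.add_mem (relations.add_mem ha hb) hc) hd) he

/-- **Homogeneity move.** `t = λs` (rule 2): `λ⁻¹·G_{A,B} ∼ G_{λ²A, λ²B}` on `(0,∞)`, for real
algebraic `λ > 0`. [this work] -/
theorem soloInformed_agm_homogeneity_move {A B l : ℝ} (hA : 0 < A) (hB : 0 < B) (hl : 0 < l)
    (hla : IsAlgebraic ℚ l) (hli : IsAlgebraic ℚ l⁻¹) (G Gl : IntegralRep 1)
    (hGd : G.domain = {x : Fin 1 → ℝ | x 0 ∈ Ioi (0:ℝ)})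
    (hGi : ∀ x, G.integrand x = (√(A + x 0 ^ 2))⁻¹ * (√(B + x 0 ^ 2))⁻¹)
    (hld : Gl.domain = {x : Fin 1 → ℝ | x 0 ∈ Ioi (0:ℝ)})
    (hli' : ∀ x, Gl.integrand x = (√(l ^ 2 * A + x 0 ^ 2))⁻¹ * (√(l ^ 2 * B + x 0 ^ 2))⁻¹) :
    of (G.constMul l⁻¹ hli) - of Gl ∈ changeOfVariablesRel := by
  have hS := soloInformed_isSemialgebraic_Ioi_zero
  refine soloInformed_lift_mem_changeOfVariablesRel (G.constMul l⁻¹ hli) Gl (g := fun s => l * s)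
    (g' := fun _ => l) (S := Ioi (0:ℝ)) (T := Ioi (0:ℝ)) (by rw [IntegralRep.domain_constMul, hGd])
    hld ?_ (fun t _ => by simpa using (hasDerivAt_id' t).const_mul l) ?_ ?_ ?_
  · rw [IntegralRep.domain_constMul, hGd]
    refine IsSemialgebraicMapOn.of_forall hS fun j => ?_
    refine ((isSemialgebraicFunOn_const_of_isAlgebraic hS hla).mul_holds
      (isSemialgebraicFunOn_aeval hS (MvPolynomial.X 0))).congr fun x _ => ?_
    simp only [Pi.mul_apply, MvPolynomial.aeval_X, soloInformedLift]
  · exact fun a _ b _ h => mul_left_cancel₀ hl.ne' h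
  · ext y
    constructor
    · rintro ⟨t, ht, rfl⟩
      exact mul_pos hl ht
    · intro hy
      exact ⟨y / l, div_pos hy hl, mul_div_cancel₀ _ hl.ne'⟩
  · intro x hx
    rw [IntegralRep.domain_constMul, hGd] at hx
    have ht : (0:ℝ) < x 0 := hx
    have hsA : √(A + x 0 ^ 2) ≠ 0 := (Real.sqrt_pos.2 (by positivity)).ne'
    have hsB : √(B + x 0 ^ 2) ≠ 0 := (Real.sqrt_pos.2 (by positivity)).ne'
    simp only [IntegralRep.integrand_constMul, hGi, hli', soloInformedLift]
    rw [show l ^ 2 * A + (l * x 0) ^ 2 = l ^ 2 * (A + x 0 ^ 2) by ring,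
      show l ^ 2 * B + (l * x 0) ^ 2 = l ^ 2 * (B + x 0 ^ 2) by ring,
      Real.sqrt_mul (sq_nonneg _), Real.sqrt_mul (sq_nonneg _), Real.sqrt_sq hl.le, abs_of_pos hl]
    field_simp

/-- **Homogeneity in `P`.** `⟦G_{λ²A, λ²B}⟧ = ⟦[pt, λ⁻¹]⟧·⟦G_{A,B}⟧`. [this work] -/
theorem soloInformed_agm_homogeneity {A B l : ℝ} (hA : 0 < A) (hB : 0 < B) (hl : 0 < l)
    (hla : IsAlgebraic ℚ l) (hli : IsAlgebraic ℚ l⁻¹) (G Gl : IntegralRep 1)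
    (hGd : G.domain = {x : Fin 1 → ℝ | x 0 ∈ Ioi (0:ℝ)})
    (hGi : ∀ x, G.integrand x = (√(A + x 0 ^ 2))⁻¹ * (√(B + x 0 ^ 2))⁻¹)
    (hld : Gl.domain = {x : Fin 1 → ℝ | x 0 ∈ Ioi (0:ℝ)})
    (hli' : ∀ x, Gl.integrand x = (√(l ^ 2 * A + x 0 ^ 2))⁻¹ * (√(l ^ 2 * B + x 0 ^ 2))⁻¹) :
    toFormalPeriod (of Gl) =
      toFormalPeriod (of (IntegralRep.unit.constMul l⁻¹ hli)) * toFormalPeriod (of G) := by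
  rw [← toFormalPeriod_of_constMul, eq_comm]
  exact toFormalPeriod_eq_iff.mpr (changeOfVariablesRel_subset_relations
    (soloInformed_agm_homogeneity_move hA hB hl hla hli G Gl hGd hGi hld hli'))

end Summit.KontsevichZagierPeriods.KontsevichZagierPeriods.Theorems

end
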